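import Literature.NumberTheory.LFunctions.DirichletExplicitRegionTheoremOne
import Literature.NumberTheory.LFunctions.CertifiedRangeDirichletZeroFreeRegion
import Literature.NumberTheory.LFunctions.NoExceptionalZeroUpToTenPowTen
import Literature.NumberTheory.LFunctions.ExceptionalModuliSmoothNumbersInProgressions
import HarnessLib

/-!
# Consumers of McCurley's Theorem 1 made McCurley-free

Topic `Literature/NumberTheory/LFunctions`. With `McCurley1984_theorem1_closed_holds` /
`McCurley1984_theorem1_holds` (`DirichletExplicitRegionTheoremOne.lean`) every tree statement of the form
`(hM : McCurley1984_theorem1{,_closed}) → …` loses that hypothesis. This file records the principal ones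
(the real-zero consumers were already served by `DirichletExplicitRegionRealZerosConsumers.lean`):
McCurley's own simplicity clause, Thorner–Zaman's Theorem 2.6 simplicity and Part 3 (modulo Platt's
certified facts only), Bennett–Martin–O'Bryant–Rechnitzer's Hypothesis `Z₁(9.645908801)` for every
`q ≥ 10`, the printed range `ZeroFreeRegionUpTo 400000 9.645908801 10` modulo Platt only, and
Lu–Zaman–Zhao's Corollary 1.2 modulo their Theorem 1.1 only, and Banks–Shparlinski's zero hypothesis
exclusions below `10¹⁰` / `3·10¹⁰` modulo the cell's value-free leaves only. Everything here is PROVED; no definitions,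
no facts (pure rewiring, each a one-line application).

## References

* K. S. McCurley, J. Number Theory 19 (1984) 7–32, Theorem 1 (p. 8). [McCurley1984ZFR]
* J. Thorner, A. Zaman, Forum Math. 36 (2024), Theorem 2.6. [ThornerZaman2024LogFree]
* M. A. Bennett, G. Martin, K. O'Bryant, A. Rechnitzer, Illinois J. Math. 62 (2018), §6. [BennettMartinOBryantRechnitzer2018]
-/

noncomputable section

open Real Complex

namespace Literature.NumberTheory.LFunctions

open ThornerZaman2024

/-- **McCurley's Theorem 1, simplicity clause, unconditionally:** a zero `s ≠ 1` of any `L(s, χ)`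
(`q ≥ 3`) in the closed region `σ ≥ 1 − 1/(R log M)` is a simple zero ("The only possible zero in this
region is a simple real zero"). [cite: McCurley1984ZFR, Theorem 1 (p. 8)] -/
theorem McCurleyStechkin.deriv_ne_zero_closedRegion {q : ℕ} [NeZero q] (hq : 3 ≤ q)
    (χ : DirichletCharacter ℂ q) {s : ℂ} (hs1 : s ≠ 1)
    (hreg : 1 - 1 / (9.645908801 * Real.log (max (max (q : ℝ) ((q : ℝ) * |s.im|)) 10)) ≤ s.re)
    (hz : χ.LFunction s = 0) : deriv χ.LFunction s ≠ 0 :=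
  McCurleyStechkin.deriv_ne_zero_of_mccurleyClosed McCurley1984_theorem1_closed_holds hq χ hs1 hreg hz

/-- **Thorner–Zaman 2024, Theorem 2.6, simplicity of the exceptional zero — modulo Platt's certified
facts only** (McCurley's Theorem 1 is now a theorem). [cite: ThornerZaman2024LogFree, Theorem 2.6] -/
theorem thornerZaman2024_theorem26_simple_of_platt (h71 : platt2016_theorem71) (h72 : platt2016_theorem72) :
    ∀ Q : ℝ, 3 ≤ Q → ∀ (q : ℕ) [NeZero q] (χ : DirichletCharacter ℂ q), (q : ℝ) ≤ Q →
      χ.IsPrimitive → ∀ β : ℝ, χ.LFunction β = 0 → 1 - zfrConst / Real.log Q ≤ β →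
        χ.IsQuadratic ∧ deriv χ.LFunction β ≠ 0 :=
  thornerZaman2024_theorem26_simple_of_mccurleyClosed_platt McCurley1984_theorem1_closed_holds h71 h72

/-- **Thorner–Zaman 2024, Theorem 2.6 Part 3 (`≤` form) — modulo Platt / Platt–Trudgian /
Mossinghoff–Trudgian–Yang only** (McCurley's Theorem 1 and Thorner–Zaman's Lemma 2.4 are theorems).
[cite: ThornerZaman2024LogFree, Theorem 2.6] -/
theorem thornerZaman2024_theorem26a_le_of_platt_rh (h71 : platt2016_theorem71) (h72 : platt2016_theorem72)
    (hRH : platt_trudgian_numerical_rh) (hZ : zero_free_region_mossinghoff_trudgian_yang) :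
    ∀ Q : ℝ, 3 ≤ Q → ∀ (q : ℕ) [NeZero q] (χ : DirichletCharacter ℂ q), (q : ℝ) ≤ Q →
      χ.IsPrimitive → ∀ ρ : ℂ, ρ ≠ 1 → ρ ≠ ((betaOne Q : ℝ) : ℂ) → χ.LFunction ρ = 0 →
        ρ.re ≤ 1 - zfrConst / Real.log (max Q (Q * |ρ.im|)) :=
  thornerZaman2024_theorem26a_le_of_mccurleyClosed McCurley1984_theorem1_closed_holds h71 h72 hRH hZ
    thornerZaman2024_lemma24_holds

/-- **The printed range `ZeroFreeRegionUpTo 400000 9.645908801 10` modulo Platt's Theorem 7.1 only.**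
[cite: BennettMartinOBryantRechnitzer2018, Definition 6.1 and Proposition 6.18] -/
theorem zeroFreeRegionUpTo_platt (hP : platt2016_theorem71) : ZeroFreeRegionUpTo 400000 9.645908801 10 :=
  zeroFreeRegionUpTo_platt_mccurley hP McCurley1984_theorem1_holds

/-- **Bennett–Martin–O'Bryant–Rechnitzer's Hypothesis `Z₁(9.645908801)` holds for every `q ≥ 10`**
("By work of McCurley we know that Hypothesis Z₁(9.645908801) holds"), unconditionally.
[cite: BennettMartinOBryantRechnitzer2018, §6 (text before Definition 6.1)] [cite: McCurley1984ZFR, Theorem 1] -/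
theorem BMOR2018.hypothesisZ₁_mccurley {q : ℕ} [NeZero q] (hq : 10 ≤ q) : BMOR2018.HypothesisZ₁ q 9.645908801 :=
  BMOR2018.hypothesisZ₁_of_mccurley McCurley1984_theorem1_holds hq

/-- **Lu–Zaman–Zhao 2026, Corollary 1.2 modulo their Theorem 1.1 only:** for `3 ≤ q ≤ 10¹⁰`, no zero of
any `L(s, χ)` (`s ≠ 1`) in `σ ≥ 1 − 1/(10 log max(q, q|t|, 10))`. [cite: LuZamanZhao2026, Corollary 1.2] -/
theorem luZamanZhao2026_corollary12_of_theorem11 (h11 : luZamanZhao2026_theorem11) {q : ℕ} [NeZero q]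
    (hq3 : 3 ≤ q) (hqQ : q ≤ 10 ^ 10) (χ : DirichletCharacter ℂ q) {s : ℂ} (hs : s ≠ 1)
    (hr : 1 - 1 / (10 * Real.log (max (max (q : ℝ) ((q : ℝ) * |s.im|)) 10)) ≤ s.re) :
    χ.LFunction s ≠ 0 :=
  luZamanZhao2026_corollary12_of h11 McCurley1984_theorem1_holds hq3 hqQ χ hs hr


/-- **Banks–Shparlinski's zero hypothesis fails for `4 ≤ q ≤ 10¹⁰`** (level `Q ≥ 10`), modulo the
value-free leaf `NoRealZeroUpTo_1e10` only (McCurley's Theorem 1 is a theorem).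
[cite: BanksShparlinski2022Soundararajan, §1.2 Theorem 1.4] [cite: McCurley1984ZFR, Theorem 1] -/
theorem BanksShparlinski2022.not_zeroHypothesis_upTo_1e10_of_leaf' (hW : NoRealZeroUpTo_1e10)
    {Q : ℝ} (hQ : 10 ≤ Q) {q : ℕ} [NeZero q] (h4 : 4 ≤ q) (hq : q ≤ 10 ^ 10) :
    ¬ ∃ (χ : DirichletCharacter ℂ q) (ρ : ℂ), ρ ≠ 1 ∧ χ.LFunction ρ = 0 ∧
        1 - 1 / (Q * Real.log ((q : ℝ) * (|ρ.im| + 3))) < ρ.re :=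
  BanksShparlinski2022.not_zeroHypothesis_upTo_1e10_of_leaf hW McCurley1984_theorem1_holds hQ h4 hq

/-- **Banks–Shparlinski's zero hypothesis fails for `4 ≤ q ≤ 3·10¹⁰`** (level `Q ≥ 10`), modulo the
value-free wide leaf `NoRealZeroUpTo_3e10` only.
[cite: BanksShparlinski2022Soundararajan, §1.2 Theorem 1.4] [cite: McCurley1984ZFR, Theorem 1] -/
theorem BanksShparlinski2022.not_zeroHypothesis_upTo_3e10_of_leaf' (hW : NoRealZeroUpTo_3e10)
    {Q : ℝ} (hQ : 10 ≤ Q) {q : ℕ} [NeZero q] (h4 : 4 ≤ q) (hq : q ≤ 3 * 10 ^ 10) :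
    ¬ ∃ (χ : DirichletCharacter ℂ q) (ρ : ℂ), ρ ≠ 1 ∧ χ.LFunction ρ = 0 ∧
        1 - 1 / (Q * Real.log ((q : ℝ) * (|ρ.im| + 3))) < ρ.re :=
  BanksShparlinski2022.not_zeroHypothesis_upTo_3e10_of_leaf hW McCurley1984_theorem1_holds hQ h4 hq

end Literature.NumberTheory.LFunctions
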